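import Literature.Claims.NS.ClayPeriodicBlowupAlternative
import Literature.Analysis.FluidPDE.NSGalerkinTrajectory
import Literature.Analysis.FunctionSpaces.TorusAgmonExplicit
import HarnessLib

/-!
# Claim skeleton (D-0090 NS-CLAIMS, C158): Higgins 2026 — «Angular Relaxation on the Integer
# Lattice and Global Regularity of 3D Navier–Stokes»

Typed skeleton of Rod Higgins (Senuamedia), *Angular Relaxation on the Integer Lattice and Global
Regularity of 3D Navier–Stokes*, Zenodo record 19601189 (v6 = latest of concept 19546998,
2026-04-16; file «effective-pde-ns-regularity.pdf», 27 pp., PDF sha16 `915074499d05567a`; PDF page =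
printed page = file `pNNN`) = bib `Higgins2026`, text of record of cell `ns-claims` row C158 (census
pin `run/shared/lean/pub/ns-claims/census/texts/Higgins2026/`, README sha16 `20c1675f6c9f6c69`; line
numbers `l.N` = lines of the pin's `pages/pNNN.txt`; lit seat's `sources/Higgins2026/LOCATORS.md` rev 2
sha16 `69d88ca5a04fac02`). UNREFEREED CLAIM under adjudication — NOTHING in this file asserts a step
of the paper: printed statements are `def … : Prop`; the `theorem`s are kernel compositions of the
paper's own implications, the Clay (B) identification through the tree's torus bridge, and one
classical fact PROVED from the tree (the blow-up alternative behind the last sentence of Thm 3.1).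
Verdict vocabulary is the refuter's / referee's.

## The claimed statement, as printed (Thm 3.1 p.8 l.36–38)
«Theorem 3.1 (Global regularity). For any smooth divergence-free initial datum u₀ on T³ and any
ν > 0, there exists a unique smooth solution u of the Navier–Stokes equations for all t > 0.»
Printed proof (p.8 l.39–61): «The Galerkin enstrophy bound (Theorem 2.6) is uniform in N:
Ω^(N)(t) ≤ Ω_max(E(0), ν) for all N and t. Compactness. … Aubin–Lions … a Leray–Hopf weak
solution u. Passage of the bound. By weak lower semicontinuity: Ω(t) ≤ lim inf Ω^(N)(t) ≤ Ω_max.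
Regularity. u ∈ L^∞(H¹) ↪ L^∞(L⁶) … Prodi–Serrin class (p = ∞, q = 6) … Therefore u is smooth
for all t > 0. Uniqueness. Prodi–Serrin gives weak–strong uniqueness».

## Setting and normalisation (Δ recorded)
The paper works with Fourier modes `k ∈ ℤ³` («integer lattice»; Galerkin truncation «Fourier
modes {|k| ≤ N}», p.4 l.44–45; §5.1.1 writes the 1-D model on `x ∈ [0, 2π]`), i.e. on
`(ℝ/2πℤ)³`, with spectral shell energy `E_K = ½ Σ_{|k|=K} |û_k|²` and shell enstrophy
`Ω_K = ½ Σ_{|k|=K} |k|² |û_k|²` (p.4 l.46–53, §5.1.3 p.15 l.28–41). This file types everything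
on the tree's unit torus `𝕋³ = UnitAddTorus (Fin 3)` (characters `e^{2πik·x}`, Mathlib
`UnitAddTorus.mFourierCoeff`), keeping the paper's SPECTRAL normalisation: `energy v = ½∫‖v‖²
= ½ Σ_k ‖v̂(k)‖²` (tree `Torus.kineticEnergy`, Parseval) and `enstrophy v := Torus.gradNormSq v /
(8π²)`, which for smooth `v` equals `½ Σ_k |k|² ‖v̂(k)‖²` with the INTEGER lattice norm `|k|`
(tree `Torus.hasSum_freq_mul_norm_sq_mFourierCoeff`). The two tori differ by the fixed NS rescaling
`u ↦ 2π u(2π·, 4π²·)` (same `ν`); none of the typed statements changes truth value under it (every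
constant the paper leaves unspecified is existentially quantified). «Shell K» («|k| = K», with
«n_K ∼ 4πK²» lattice points, p.1 l.14, p.3 l.52) is typed as the nearest-integer shell
`K − ½ ≤ |k| < K + ½` — the pseudo-spectral convention consistent with `n_K ∼ 4πK²` and with
Thm 2.3's threshold `N ≥ 2K + 1` (the literal sphere `|k|² = K²` has an irregular point count);
shell `K = 0` is the mean mode `k = 0`, which carries no enstrophy. Clay (B) is reached through the
tree's Δ1 bridge `ClayVariants.navierStokesExistenceSmoothPeriodic_iff_torus` (unit period; Fefferman
(8)/(10)/(11)): `clay_of_claimed` PROVED.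

## The working object
«Let u^(N) denote the Galerkin approximation at truncation N, with Fourier modes {|k| ≤ N}»
(p.4 l.44–45) = the tree's field-level Fourier–Galerkin trajectory
`Literature.Analysis.FluidPDE.Torus.IsGalerkinTrajectory ν 0 N U` (unforced, order `N` = Fourier
ball `|k|² ≤ N²`, exact energy identity; `NSGalerkinTrajectory.lean`) started at the truncation
`U 0 = Torus.fourierTruncate N u₀` of the datum: `IsGalerkinSol ν N u₀ U`. Existence for every
Galerkin datum: tree `Torus.exists_isGalerkinTrajectory_of_isGalerkinMode`; a single Fourier mode
(e.g. the shear `A sin(2πmz)e_x`) of frequency `m ≤ N` is its own truncation.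

## Architecture of the printed argument and the typed Steps (dependency order, TYPING-HYGIENE 11)
The proof of Thm 3.1 consumes Thm 2.6 and two classical passages; Thm 2.6's printed proof
(p.7 l.26 – p.8 l.25) invokes, in print order: the Phase-1 bound, Thm 2.1, Thm 2.5 (⇐ Lemma 2.4 ⇐
Thm 2.3 of [1]), and items (3)–(5) of Remark 2.7 (Kolmogorov cascade phenomenology). Index:
* Step 1 = `Phase1Bound` — p.7 l.27–30 «Ω^(N)(t) ≤ N²E(0)» (TRUE-type: band limit + energy
  identity; not yet discharged here).
* Step 2 = `Theorem21_RK` / `Theorem21_mono` — Thm 2.1 (Cumulative balance) p.5 l.59–62, typed AS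
  ASSERTED for «smooth initial data on T³» (RULINGS v1.38 (1); REF-4 flag (c)); the printed qualifier
  «with energy E(0) distributed across all shells (no cascade transient)» is not a mathematical
  condition and is quoted, not typed; the typist's definite reading of it («every shell 1 … N
  carries energy at t = 0») is the alongside face `Theorem21_RK_pop` / `Theorem21_mono_pop`.
  Printed «Proof (computational). Direct measurement from DNS at N = 8 with ν = 0.01 …» (p.5
  l.63 – p.6 l.13); Remark 2.2 p.6 l.14–20 states that pulse data violate `R_K < 1` «during the
  cascade transient».
* Step 3 = `Theorem23_coupling` — Thm 2.3 (Triad Graph Saturation, imported from [1]) p.6 l.24–26,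
  typed at the grain the page states (l.26 «Every pair of modes within shell K is coupled by the NS
  nonlinearity»): for `N ≥ 2K + 1` the difference of two shell-`K` wave vectors is a retained mode.
  TRUE-type lattice fact; the graph `G_K` / «Fiedler value λ₁ = n_K» live in [1] and are not re-typed.
* (not typable from the text of record) Lemma 2.4 p.6 l.27–43 «⟨Γ_K⟩_{[t₁,t₂]} ≥ c₀K²√⟨E_K⟩ for
  t₂ − t₁ ≥ T₀(K)» («Proof (analytical structure, numerically verified)») and Thm 2.5 p.7 l.7–16
  «⟨|S_K|⟩_T ≤ C₃K⟨√Ω_K⟩_T, C₃ = C_Sσ²/(c₀√4π)»: the symbols `Γ_K` (angular relaxation rate), `V_K`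
  («per-mode angular energy variance»), the «intra» derivative, `T₀(K)` («eddy-turnover time»), the
  split of the nonlinear enstrophy transfer into `S_K` («vortex-stretching contribution») and `F_K`
  («conservative inter-shell flux»), and the «structural constants» `σ, c₀, C_S` are NOT DEFINED on
  pp.1–8 (§4's effective-PDE quantities are declared outside the proof chain, §1.3 p.4 l.25–28). Only
  the SUM `S_K + F_K` is determined by (1)/(3) (it equals `Ω_K(T) − Ω_K(0) + ∫₀ᵀ 2νK²Ω_K`), which is
  how `cumRatio` (R_K, p.5 l.49–56) is typed. Thm 2.6's printed proof uses Thm 2.5 only in the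
  sentence p.7 l.33–34 «gives the per-shell decay rate»; the displayed derivation of `Ω_max` does not.
* Step 4 = `Kol_perShell` — the quantitative heart of Thm 2.6's printed proof, p.7 l.44–48 with p.8
  l.1–2: «the high-K spectrum satisfies E_K ≤ Π₀/(2νK²), giving Ω_K = K²E_K ≤ Π₀/(2ν) — a constant
  per shell» ∧ «Π₀ ≤ C·E(0)^{3/2}» (Remark 2.7 items (3)–(4)); `Π_K`, `Π₀` («energy cascade rate at
  K = 1»), «steady state» are not defined for the Galerkin trajectory, so the Step is typed as the
  CONJUNCTION'S CONSEQUENCE the proof uses: `K²E_K(t) ≤ C E(0)^{3/2}/(2ν)` for every trajectory, shell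
  and time. `Kol_tail` = item (5) / display (5) p.7 l.49–65 («beyond K_d ∼ (Π₀/ν³)^{1/4} … exponentially
  small», «≈ K_d·Π₀/(2ν)») typed as: the enstrophy above `K_d` is at most of the same order.
  GLUE «(3)–(5) ⇒ (4) with Ω_max = C′E(0)^{15/8}/ν^{7/4}» (p.8 l.3–21) is finite-sum arithmetic on
  `Ω^(N) = Σ_{K ≤ N} Ω_K`; REF-4 flag (e) asks for it as a typed implication — NOT proved in this rev
  (typist: composes on paper; kernel proof = rev 2 `thm26_explicit_of_kol`, append-only).
* Step 5 = `Theorem26` — Thm 2.6 (Global enstrophy bound) display (4) p.7 l.18–25, AS PRINTED: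
  `∃ Ω_max : ℝ → ℝ → ℝ` (a function of `(E(0), ν)` only, l.24–25 «depends on E(0), ν, and the
  structural constants σ, c₀, but not on N»; REF-4 flag (a)), for every datum, `ν > 0`, `N`, `t ≥ 0`.
  Faces alongside: `Theorem26_max` (the lineage record 19701937's form «≤ max(Ω(0), Ω_max(E(0), ν))»,
  census README / REF-4 (a)) and `Theorem26_explicit` (p.8 l.3–21 «Ω_max ≤ C′·E(0)^{15/8}/ν^{7/4}»;
  `theorem26_of_explicit` PROVED). Typist's flag: (4) is asserted «for all t ≥ 0», hence at `t = 0`,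
  where `Ω^(N)(0) = Ω(P_N u₀)` is not controlled by `E(0)` (census README's single-mode family).
* Step 6 = `GalerkinPassage` — p.8 l.41–56 (Compactness + Passage of the bound): an `N`-uniform
  bound on the Galerkin enstrophies from `P_N u₀` bounds the enstrophy of every classical solution
  from `u₀` on its interval of existence (Galerkin convergence + weak l.s.c.). TRUE-type classical
  (Robinson–Rodrigo–Sadowski 2016 §4, Constantin–Foias 1988 Ch. 8); not in the tree by name.
* Step 7 = `Regularity31` — p.8 l.57–61 (Regularity + Uniqueness): an a priori enstrophy bound for
  every classical solution from `u₀` on every `[0, T)` ⇒ a unique global classical solution.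
  PROVED (`regularity31_holds`) from the tree's maximal solution / enstrophy blow-up alternative
  `Torus.exists_maximal_classicalNS_anyMean` (RRS 2016 §6.3, §8.1) — the paper's Prodi–Serrin
  sentence is replaced by the tree's equivalent door (deviation recorded).
* Abstract-route companions (p.1 l.28–47, «The argument has three steps»), typed alongside, NOT
  binders: `Abstract_ODE` (l.39–41 «the sublinear ODE dΩ_K/dt ≤ C₃K√Ω_K − 2νK²Ω_K», integrated
  form, `F_K` absent as printed there; §2.2 p.5 l.34–36 disavows instantaneous bounds) and
  `Abstract_perShell` (l.22–27 / l.42–46 «Ω_K ≤ C₃²/(4ν²K²)» at every shell, as printed for all `t`).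
  Typist's flag: the saturation hypothesis `N ≥ 2K + 1` covers only shells `K ≤ (N−1)/2`.

COMPOSITION: `claim_of_steps : Theorem26 → GalerkinPassage → Regularity31 → ClaimedTheorem` and
`claim_of_steps_max : Theorem26_max → GalerkinPassage → Regularity31 → ClaimedTheorem` PROVED (pure
logic); with `regularity31_holds`: `claim_of_thm26 : Theorem26 → GalerkinPassage → ClaimedTheorem`.
`clay_of_claimed : ClaimedTheorem → ClayVariants.clayPeriodic.Regularity` PROVED (Clay (B), leaf
`NavierStokesExistenceSmoothPeriodic`; `claimedExistence_of_clayB` the converse for the existence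
half); `claimedUniqueness_holds : ClaimedUniqueness` PROVED unconditionally (tree maximal solution). COMPOSITION OF THM 2.6 FROM ITS PRINTED PROOF: not a kernel
object in this rev — of its inputs only Step 1, Step 2, Step 3 and the consequence-grain Step 4 are
statements about defined quantities (see above); the load therefore sits in `Theorem26` (binder 1).

Cell files: `claims/Higgins2026/CARD.md` (typist-7 g7; PREDICTION sealed 2026-08-27T11:34:03Z, sha16
5249080e01c2dfb9). WHAT THIS IS NOT: not a claim about NS regularity or blow-up; not a claim about
any author beyond the typed locator.
-/

noncomputable section

open MeasureTheory Set Filter Topology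
open scoped ENNReal NNReal ContDiff RealInnerProductSpace

namespace Literature.Claims.NS.Higgins2026

open Literature.Analysis Literature.Analysis.FluidPDE Literature.Analysis.FunctionSpaces
  Literature.Claims.NS.ClayVariants

/-! ## Vocabulary (paper's spectral normalisation on the integer lattice) -/

/-- The torus `𝕋³`. [cite: Higgins2026, Thm 3.1 p.8 l.36] -/
abbrev T3 : Type := UnitAddTorus (Fin 3)

/-- Velocity values `ℝ³`. [folklore] -/
abbrev E3 : Type := EuclideanSpace ℝ (Fin 3)

/-- Complex Fourier coefficients `ℂ³`. [folklore] -/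
abbrev C3 : Type := EuclideanSpace ℂ (Fin 3)

/-- The integer lattice `ℤ³` of wave vectors. [cite: Higgins2026, §2.1 p.4 l.44–45] -/
abbrev Z3 : Type := Fin 3 → ℤ

/-- The vector Fourier coefficient `û_k ∈ ℂ³` (characters `e^{2πik·x}`, Mathlib `mFourierCoeff` of
the complexified field, as in the tree's `Torus.eSobolevNorm`). [cite: Higgins2026, §2.1 p.4 l.46–53] -/
def coeff (v : T3 → E3) (k : Z3) : C3 :=
  UnitAddTorus.mFourierCoeff (EuclideanSpace.complexify ∘ v) k

/-- The integer lattice norm `|k| = √(Σᵢ kᵢ²)`. [cite: Higgins2026, §2.1 p.4 l.44–45] -/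
def latt (k : Z3) : ℝ := Real.sqrt (Torus.freqNormSq k)

/-- **Shell `K`** («|k| = K», `n_K ∼ 4πK²` points, p.3 l.50–52): the nearest-integer shell
`K − ½ ≤ |k| < K + ½` as a finite set (coordinates of such `k` lie in `[−K, K]`); `K = 0` is `{0}`.
[cite: Higgins2026, §1.2 p.3 l.50–52; §2.1 p.4 l.46–53] -/
def shell (K : ℕ) : Finset Z3 :=
  (Fintype.piFinset fun _ : Fin 3 => Finset.Icc (-(K : ℤ)) K).filter
    fun k => (K : ℝ) - 1 / 2 ≤ latt k ∧ latt k < (K : ℝ) + 1 / 2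

/-- Shell energy `E_K = ½ Σ_{k ∈ shell K} |û_k|²`. [cite: Higgins2026, §5.1.3 p.15 l.28–33; §2.1 p.4 l.46–53] -/
def shellEnergy (K : ℕ) (v : T3 → E3) : ℝ :=
  2⁻¹ * ∑ k ∈ shell K, ‖coeff v k‖ ^ 2

/-- Shell enstrophy `Ω_K = ½ Σ_{k ∈ shell K} |k|² |û_k|²`. [cite: Higgins2026, §2.1 p.4 l.46–53] -/
def shellEnstrophy (K : ℕ) (v : T3 → E3) : ℝ :=
  2⁻¹ * ∑ k ∈ shell K, Torus.freqNormSq k * ‖coeff v k‖ ^ 2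

/-- Total energy `E = ½∫_{𝕋³}‖v‖² = ½ Σ_k |û_k|²` (Parseval): the tree's `Torus.kineticEnergy`.
[cite: Higgins2026, §2.1 p.5 l.8–10] -/
def energy (v : T3 → E3) : ℝ := Torus.kineticEnergy v

/-- Total enstrophy in the paper's spectral normalisation, `Ω = ½ Σ_k |k|² |û_k|²`, typed as
`‖∇v‖₂²/(8π²)` (the tree's `Torus.gradNormSq`; the two agree on smooth fields by
`Torus.hasSum_freq_mul_norm_sq_mFourierCoeff`). For the Galerkin field this is `Ω^(N) = Σ_{K ≤ N} Ω_K`.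
[cite: Higgins2026, §1 p.3 l.9–13; §2.1 p.4 l.46–53] -/
def enstrophy (v : T3 → E3) : ℝ := Torus.gradNormSq v / (8 * Real.pi ^ 2)

/-- A datum of Thm 3.1: «smooth divergence-free initial datum u₀ on T³» (no mean-zero clause is
printed). [cite: Higgins2026, Thm 3.1 p.8 l.36–38] -/
def IsDatum (u₀ : T3 → E3) : Prop := Torus.IsSmooth u₀ ∧ Torus.IsDivFree u₀

/-- **«The Galerkin approximation at truncation N, with Fourier modes {|k| ≤ N}»** (p.4 l.44–45):
the tree's unforced field-level Fourier–Galerkin trajectory of order `N` started at the truncation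
`P_N u₀`. [cite: Higgins2026, §2.1 p.4 l.44–45] [cite: RobinsonRodrigoSadowski2016, §4.1 Def. 4.2] -/
def IsGalerkinSol (ν : ℝ) (N : ℕ) (u₀ : T3 → E3) (U : ℝ → T3 → E3) : Prop :=
  Torus.IsGalerkinTrajectory ν 0 N U ∧ U 0 = Torus.fourierTruncate N u₀

/-- Cumulative dissipation at shell `K` on `[0, T]`: `∫₀ᵀ 2νK²Ω_K dt` (denominator of `R_K`, p.5
l.49–56; junk-free: the integrand is continuous along a Galerkin trajectory). [cite: Higgins2026, §2.3 p.5 l.48–56] -/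
def cumDissipation (ν : ℝ) (K : ℕ) (U : ℝ → T3 → E3) (T : ℝ) : ℝ :=
  ∫ t in (0 : ℝ)..T, 2 * ν * (K : ℝ) ^ 2 * shellEnstrophy K (U t)

/-- **The cumulative stretching-to-dissipation ratio** `R_K(T) := ∫₀ᵀ(S_K + F_K)dt / ∫₀ᵀ 2νK²Ω_K dt`
(p.5 l.49–56), with the numerator ELIMINATED through the paper's exact identity (3) p.5 l.39–47
(`∫₀ᵀ(S_K + F_K) = Ω_K(T) − Ω_K(0) + ∫₀ᵀ 2νK²Ω_K`) — the only form in which `S_K + F_K` is defined by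
the text. Junk: `x / 0 = 0` on a shell with zero cumulative dissipation (the Steps guard it).
[cite: Higgins2026, §2.3 (3) p.5 l.38–56] -/
def cumRatio (ν : ℝ) (K : ℕ) (U : ℝ → T3 → E3) (T : ℝ) : ℝ :=
  (shellEnstrophy K (U T) - shellEnstrophy K (U 0) + cumDissipation ν K U T) / cumDissipation ν K U T

/-- The typist's definite reading of «energy E(0) distributed across all shells (no cascade
transient)» (Thm 2.1 p.5 l.59–61): every shell `1 ≤ K ≤ N` of the Galerkin datum carries energy.
[cite: Higgins2026, Thm 2.1 p.5 l.59–61; §5.1.2 (D) p.15 l.24–25] -/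
def AllShellsPopulated (N : ℕ) (u₀ : T3 → E3) : Prop :=
  ∀ K : ℕ, 1 ≤ K → K ≤ N → 0 < shellEnergy K (Torus.fourierTruncate N u₀)

/-! ## The claimed statement (Thm 3.1 p.8 l.36–38) -/

/-- **Existence half of Thm 3.1**: for every `ν > 0` and every smooth divergence-free `u₀` on `𝕋³`, a
classical solution `(u, p)` of the unforced system on `𝕋³ × [0, ∞)` with `u(0) = u₀`.
[claim: Higgins2026, status: under-review] [cite: Higgins2026, Thm 3.1 p.8 l.36–38] -/
def ClaimedExistence : Prop :=
  ∀ ν : ℝ, 0 < ν → ∀ u₀ : T3 → E3, Torus.IsSmooth u₀ → Torus.IsDivFree u₀ →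
    ∃ (u : ℝ → T3 → E3) (p : ℝ → T3 → ℝ), Torus.IsClassicalNSSolutionOn (Ici 0) ν 0 u p ∧ u 0 = u₀

/-- **Uniqueness half of Thm 3.1** («a unique smooth solution … for all t > 0»): any two classical
solutions on `𝕋³ × [0, ∞)` from the same smooth divergence-free datum have the same velocity.
[claim: Higgins2026, status: under-review] [cite: Higgins2026, Thm 3.1 p.8 l.36–38, l.61] -/
def ClaimedUniqueness : Prop :=
  ∀ ν : ℝ, 0 < ν → ∀ u₀ : T3 → E3, Torus.IsSmooth u₀ → Torus.IsDivFree u₀ →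
    ∀ (u v : ℝ → T3 → E3) (p q : ℝ → T3 → ℝ),
      Torus.IsClassicalNSSolutionOn (Ici 0) ν 0 u p → u 0 = u₀ →
      Torus.IsClassicalNSSolutionOn (Ici 0) ν 0 v q → v 0 = u₀ → ∀ t : ℝ, 0 ≤ t → v t = u t

/-- **CLAIMED THEOREM = Thm 3.1 p.8 l.36–38** (existence ∧ uniqueness).
[claim: Higgins2026, status: under-review] [cite: Higgins2026, Thm 3.1 p.8 l.36–38] -/
def ClaimedTheorem : Prop := ClaimedExistence ∧ ClaimedUniqueness

/-! ## The Steps of the printed argument -/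

/-- **Step 1 — Phase-1 bound, p.7 l.27–30**: «since total energy E(t) ≤ E(0), the enstrophy
satisfies the trivial bound Ω^(N)(t) ≤ N²E(0) at truncation N». TRUE-type (band limit `|k| ≤ N` +
the Galerkin energy identity; `E(P_N u₀) ≤ E(u₀)`). [claim: Higgins2026, status: under-review] [cite: Higgins2026, Thm 2.6 proof p.7 l.27–30; (2) p.5 l.8–16] -/
def Phase1Bound : Prop :=
  ∀ ν : ℝ, 0 < ν → ∀ u₀ : T3 → E3, IsDatum u₀ → ∀ (N : ℕ) (U : ℝ → T3 → E3),
    IsGalerkinSol ν N u₀ U → ∀ t : ℝ, 0 ≤ t → enstrophy (U t) ≤ (N : ℝ) ^ 2 * energy u₀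

/-- **Step 2 (face R) — Thm 2.1 (Cumulative balance) p.5 l.59–62, AS ASSERTED**: «For smooth
initial data on T³ with energy E(0) distributed across all shells (no cascade transient), the
cumulative ratio satisfies R_K(T) < 1 for all K ≥ 1 and all T > 0.» Typed for every smooth
divergence-free datum and every truncation `N` (the qualifier in guillemets is not a mathematical
condition — quoted, not typed; see `Theorem21_RK_pop`), on shells with positive cumulative
dissipation (guard against `x/0`). Printed proof: «(computational). Direct measurement from DNS at
N = 8 with ν = 0.01 and broadspectrum initial data», table p.6 l.1–13.
[claim: Higgins2026, status: under-review] [cite: Higgins2026, Thm 2.1 p.5 l.59 – p.6 l.13; Remark 2.2 p.6 l.14–20] -/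
def Theorem21_RK : Prop :=
  ∀ ν : ℝ, 0 < ν → ∀ u₀ : T3 → E3, IsDatum u₀ → ∀ (N : ℕ) (U : ℝ → T3 → E3),
    IsGalerkinSol ν N u₀ U → ∀ K : ℕ, 1 ≤ K → ∀ T : ℝ, 0 < T →
      0 < cumDissipation ν K U T → cumRatio ν K U T < 1

/-- **Step 2 (face Ω) — Thm 2.1, «In particular, Ω(T) ≤ Ω(0) for all T»** (p.5 l.62), AS ASSERTED for
every smooth divergence-free datum and truncation (`Ω(0)` = the Galerkin enstrophy at `t = 0`).
[claim: Higgins2026, status: under-review] [cite: Higgins2026, Thm 2.1 p.5 l.59–62] -/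
def Theorem21_mono : Prop :=
  ∀ ν : ℝ, 0 < ν → ∀ u₀ : T3 → E3, IsDatum u₀ → ∀ (N : ℕ) (U : ℝ → T3 → E3),
    IsGalerkinSol ν N u₀ U → ∀ T : ℝ, 0 < T → enstrophy (U T) ≤ enstrophy (U 0)

/-- Step 2, typist's alongside face of `Theorem21_RK` with the qualifier read as
`AllShellsPopulated`. [claim: Higgins2026, status: under-review] [cite: Higgins2026, Thm 2.1 p.5 l.59–62] -/
def Theorem21_RK_pop : Prop :=
  ∀ ν : ℝ, 0 < ν → ∀ u₀ : T3 → E3, IsDatum u₀ → ∀ (N : ℕ), AllShellsPopulated N u₀ →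
    ∀ (U : ℝ → T3 → E3), IsGalerkinSol ν N u₀ U → ∀ K : ℕ, 1 ≤ K → ∀ T : ℝ, 0 < T →
      0 < cumDissipation ν K U T → cumRatio ν K U T < 1

/-- Step 2, typist's alongside face of `Theorem21_mono` with the qualifier read as
`AllShellsPopulated`. [claim: Higgins2026, status: under-review] [cite: Higgins2026, Thm 2.1 p.5 l.59–62] -/
def Theorem21_mono_pop : Prop :=
  ∀ ν : ℝ, 0 < ν → ∀ u₀ : T3 → E3, IsDatum u₀ → ∀ (N : ℕ), AllShellsPopulated N u₀ →
    ∀ (U : ℝ → T3 → E3), IsGalerkinSol ν N u₀ U → ∀ T : ℝ, 0 < T → enstrophy (U T) ≤ enstrophy (U 0)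

/-- **Step 3 — Thm 2.3 (Triad Graph Saturation, [1]) p.6 l.24–26**, at the grain the page states
(l.26 «Every pair of modes within shell K is coupled by the NS nonlinearity. No angular
configuration avoids this coupling.»): for `N ≥ 2K + 1` and `k ≠ p` in shell `K`, the mediating
wave vector `k − p` is a retained mode, `|k − p| ≤ N`. TRUE-type (nearest-integer shells:
`|k − p| < 2K + 1`). The graph `G_K = K_{n_K}` and «Fiedler value λ₁ = n_K» are [1]'s objects, not
re-typed. [claim: Higgins2026, status: under-review] [cite: Higgins2026, Thm 2.3 p.6 l.24–26] -/
def Theorem23_coupling : Prop :=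
  ∀ N K : ℕ, 2 * K + 1 ≤ N → ∀ k ∈ shell K, ∀ p ∈ shell K, k ≠ p →
    Torus.freqNormSq (k - p) ≤ (N : ℝ) ^ 2

/-- **Step 4 — the per-shell spectrum bound of Thm 2.6's printed proof**, p.7 l.44–48 «the high-K
spectrum satisfies E_K ≤ Π₀/(2νK²), giving Ω_K = K²E_K ≤ Π₀/(2ν) — a constant per shell» combined
with p.8 l.1–2 «By dimensional analysis, Π₀ ≤ C·E(0)^{3/2} for decaying turbulence» (Remark 2.7
items (3)–(4) p.8 l.27–28): typed as the consequence the proof uses, for every trajectory, every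
shell `K ≥ 1` and every `t ≥ 0` (`Π_K`, `Π₀`, «steady state» are not defined for the Galerkin
trajectory in the text). [claim: Higgins2026, status: under-review] [cite: Higgins2026, Thm 2.6 proof p.7 l.44–48, p.8 l.1–2; Remark 2.7 (3)–(4) p.8 l.26–31] -/
def Kol_perShell : Prop :=
  ∃ C : ℝ, 0 < C ∧ ∀ ν : ℝ, 0 < ν → ∀ u₀ : T3 → E3, IsDatum u₀ → ∀ (N : ℕ) (U : ℝ → T3 → E3),
    IsGalerkinSol ν N u₀ U → ∀ t : ℝ, 0 ≤ t → ∀ K : ℕ, 1 ≤ K →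
      (K : ℝ) ^ 2 * shellEnergy K (U t) ≤ C * energy u₀ ^ (3 / 2 : ℝ) / (2 * ν)

/-- **Step 4 (tail) — display (5) p.7 l.49–65 with item (5)**: «The inertial range extends up to the
dissipation scale K_d ∼ (Π₀/ν³)^{1/4}, beyond which E_K decays exponentially … Ω ≤ Σ_{K≤K_d} Π₀/(2ν)
+ Σ_{K>K_d} (exponentially small) ≈ K_d·Π₀/(2ν)», typed (with `Π₀ = C E(0)^{3/2}`) as: the enstrophy
carried above `K_d` is at most `C′ K_d Π₀/ν`. [claim: Higgins2026, status: under-review] [cite: Higgins2026, Thm 2.6 proof (5) p.7 l.49–65; Remark 2.7 (5) p.8 l.28–30] -/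
def Kol_tail : Prop :=
  ∃ C C' : ℝ, 0 < C ∧ 0 < C' ∧ ∀ ν : ℝ, 0 < ν → ∀ u₀ : T3 → E3, IsDatum u₀ →
    ∀ (N : ℕ) (U : ℝ → T3 → E3), IsGalerkinSol ν N u₀ U → ∀ t : ℝ, 0 ≤ t →
      ∑ K ∈ (Finset.range (N + 1)).filter
          (fun K : ℕ => (C * energy u₀ ^ (3 / 2 : ℝ) / ν ^ 3) ^ (1 / 4 : ℝ) < (K : ℝ)),
        shellEnstrophy K (U t) ≤
        C' * (C * energy u₀ ^ (3 / 2 : ℝ) / ν ^ 3) ^ (1 / 4 : ℝ) * (C * energy u₀ ^ (3 / 2 : ℝ)) / ν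

/-- **Step 5 — Thm 2.6 (Global enstrophy bound), display (4) p.7 l.18–25, AS PRINTED**: «For smooth
divergence-free initial data u₀ on T³ and ν > 0, the Galerkin enstrophy satisfies
Ω^(N)(t) ≤ Ω_max(E(0), ν) < ∞ (4) for all t ≥ 0 and all N, where Ω_max depends on E(0), ν, and the
structural constants σ, c₀, but not on N.» — ONE function `Ω_max` of `(E(0), ν)`, quantified outside
the datum (REF-4 flag (a)); `t ≥ 0` includes `t = 0`, where `Ω^(N)(0) = Ω(P_N u₀)`.
[claim: Higgins2026, status: under-review] [cite: Higgins2026, Thm 2.6 (4) p.7 l.18–25] -/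
def Theorem26 : Prop :=
  ∃ Ωmax : ℝ → ℝ → ℝ, ∀ ν : ℝ, 0 < ν → ∀ u₀ : T3 → E3, IsDatum u₀ → ∀ (N : ℕ) (U : ℝ → T3 → E3),
    IsGalerkinSol ν N u₀ U → ∀ t : ℝ, 0 ≤ t → enstrophy (U t) ≤ Ωmax (energy u₀) ν

/-- **Step 5, lineage face** (record 19701937 Thm 3.1's form «max(Ω(0), ·)», census README; the
referee's charitable re-typing candidate, typed alongside per REF-4 flag (a), not instead):
`Ω^(N)(t) ≤ max(Ω(u₀), Ω_max(E(0), ν))`. [claim: Higgins2026, status: under-review] [cite: Higgins2026, Thm 2.6 (4) p.7 l.18–25] -/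
def Theorem26_max : Prop :=
  ∃ Ωmax : ℝ → ℝ → ℝ, ∀ ν : ℝ, 0 < ν → ∀ u₀ : T3 → E3, IsDatum u₀ → ∀ (N : ℕ) (U : ℝ → T3 → E3),
    IsGalerkinSol ν N u₀ U → ∀ t : ℝ, 0 ≤ t →
      enstrophy (U t) ≤ max (enstrophy u₀) (Ωmax (energy u₀) ν)

/-- **Step 5, explicit face** — p.8 l.3–21 «Ω_max ≤ C′·E(0)^{15/8}/ν^{7/4}, which is finite for all
E(0) < ∞ and ν > 0» (one constant `C′`). [claim: Higgins2026, status: under-review] [cite: Higgins2026, Thm 2.6 proof p.8 l.1–21] -/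
def Theorem26_explicit : Prop :=
  ∃ C' : ℝ, 0 < C' ∧ ∀ ν : ℝ, 0 < ν → ∀ u₀ : T3 → E3, IsDatum u₀ → ∀ (N : ℕ) (U : ℝ → T3 → E3),
    IsGalerkinSol ν N u₀ U → ∀ t : ℝ, 0 ≤ t →
      enstrophy (U t) ≤ C' * energy u₀ ^ (15 / 8 : ℝ) / ν ^ (7 / 4 : ℝ)

/-- **Step 6 — Galerkin limit / passage of the bound, p.8 l.41–56** («Compactness … Aubin–Lions …
Passage of the bound. By weak lower semicontinuity: Ω(t) ≤ lim inf Ω^(N)(t) ≤ Ω_max»), typed for the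
object the regularity sentence needs: an `N`-uniform bound on the Galerkin enstrophies from `P_N u₀`
bounds the enstrophy of EVERY classical solution from `u₀` on its interval `[0, T)`. TRUE-type
classical (convergence of the Galerkin approximations to the strong solution while it exists).
[claim: Higgins2026, status: under-review] [cite: Higgins2026, Thm 3.1 proof p.8 l.41–56] [cite: RobinsonRodrigoSadowski2016, Thm. 4.4, §6.3] -/
def GalerkinPassage : Prop :=
  ∀ ν : ℝ, 0 < ν → ∀ u₀ : T3 → E3, IsDatum u₀ → ∀ B : ℝ,
    (∀ (N : ℕ) (U : ℝ → T3 → E3), IsGalerkinSol ν N u₀ U → ∀ t : ℝ, 0 ≤ t → enstrophy (U t) ≤ B) →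
    ∀ (T : ℝ) (v : ℝ → T3 → E3) (q : ℝ → T3 → ℝ),
      Torus.IsClassicalNSSolutionOn (Ico 0 T) ν 0 v q → v 0 = u₀ →
        ∀ t ∈ Ico 0 T, enstrophy (v t) ≤ B

/-- **Step 7 — Regularity + Uniqueness, p.8 l.57–61** («u ∈ L^∞(H¹) ↪ L^∞(L⁶) … Prodi–Serrin class
(p = ∞, q = 6) … Therefore u is smooth for all t > 0. Uniqueness …»), typed as the a priori door: if
every classical solution from `u₀` on every half-open slab has bounded enstrophy, then a unique
global classical solution exists. PROVED below from the tree (`regularity31_holds`).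
[claim: Higgins2026, status: under-review] [cite: Higgins2026, Thm 3.1 proof p.8 l.57–61] [cite: RobinsonRodrigoSadowskiCUP2016, §6.3, §8.1] -/
def Regularity31 : Prop :=
  ∀ ν : ℝ, 0 < ν → ∀ u₀ : T3 → E3, IsDatum u₀ →
    (∃ B : ℝ, ∀ (T : ℝ) (v : ℝ → T3 → E3) (q : ℝ → T3 → ℝ),
      Torus.IsClassicalNSSolutionOn (Ico 0 T) ν 0 v q → v 0 = u₀ → ∀ t ∈ Ico 0 T, enstrophy (v t) ≤ B) →
    (∃ (u : ℝ → T3 → E3) (p : ℝ → T3 → ℝ), Torus.IsClassicalNSSolutionOn (Ici 0) ν 0 u p ∧ u 0 = u₀) ∧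
    ∀ (u v : ℝ → T3 → E3) (p q : ℝ → T3 → ℝ),
      Torus.IsClassicalNSSolutionOn (Ici 0) ν 0 u p → u 0 = u₀ →
      Torus.IsClassicalNSSolutionOn (Ici 0) ν 0 v q → v 0 = u₀ → ∀ t : ℝ, 0 ≤ t → v t = u t

/-- **Abstract route, step (3) p.1 l.39–41** «the sublinear ODE dΩ_K/dt ≤ C₃K√Ω_K − 2νK²Ω_K»
(`C₃` structural; the inter-shell flux `F_K` of (1) is absent, as printed there), integrated form on
every `[s, t] ⊆ [0, ∞)`, for saturated shells `N ≥ 2K + 1`. Alongside only (§2.2 p.5 l.34–36: «any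
proof based on an instantaneous bound Γ_K > 0 would be incorrect»). [claim: Higgins2026, status: under-review] [cite: Higgins2026, Abstract p.1 l.39–41; (1) p.4 l.55–56] -/
def Abstract_ODE : Prop :=
  ∃ C₃ : ℝ, 0 < C₃ ∧ ∀ ν : ℝ, 0 < ν → ∀ u₀ : T3 → E3, IsDatum u₀ → ∀ (N : ℕ) (U : ℝ → T3 → E3),
    IsGalerkinSol ν N u₀ U → ∀ K : ℕ, 1 ≤ K → 2 * K + 1 ≤ N → ∀ s t : ℝ, 0 ≤ s → s ≤ t →
      shellEnstrophy K (U t) - shellEnstrophy K (U s) ≤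
        ∫ τ in s..t, (C₃ * K * Real.sqrt (shellEnstrophy K (U τ)) -
          2 * ν * (K : ℝ) ^ 2 * shellEnstrophy K (U τ))

/-- **Abstract route, per-shell bound p.1 l.22–27 / l.42–46** «a per-shell bound Ω_K ≤ C₃²/(4ν²K²)»,
«has a finite attractor Ω_K ≤ C₃²/(4ν²K²) at every shell», as printed for all `t`; alongside only.
[claim: Higgins2026, status: under-review] [cite: Higgins2026, Abstract p.1 l.19–27, l.39–46] -/
def Abstract_perShell : Prop :=
  ∃ C₃ : ℝ, 0 < C₃ ∧ ∀ ν : ℝ, 0 < ν → ∀ u₀ : T3 → E3, IsDatum u₀ → ∀ (N : ℕ) (U : ℝ → T3 → E3),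
    IsGalerkinSol ν N u₀ U → ∀ K : ℕ, 1 ≤ K → 2 * K + 1 ≤ N → ∀ t : ℝ, 0 ≤ t →
      shellEnstrophy K (U t) ≤ C₃ ^ 2 / (4 * ν ^ 2 * (K : ℝ) ^ 2)

/-! ## Kernel relations -/

/-- The explicit face implies the literal Thm 2.6 (take `Ω_max(E, ν) = C′E^{15/8}/ν^{7/4}`).
[cite: Higgins2026, Thm 2.6 proof p.8 l.1–21] -/
theorem theorem26_of_explicit (h : Theorem26_explicit) : Theorem26 := by
  obtain ⟨C', -, hC⟩ := h
  exact ⟨fun E ν => C' * E ^ (15 / 8 : ℝ) / ν ^ (7 / 4 : ℝ), hC⟩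

/-- The literal Thm 2.6 implies the lineage face. [cite: Higgins2026, Thm 2.6 (4) p.7 l.18–25] -/
theorem theorem26_max_of (h : Theorem26) : Theorem26_max := by
  obtain ⟨Ωmax, hΩ⟩ := h
  exact ⟨Ωmax, fun ν hν u₀ hu₀ N U hU t ht => (hΩ ν hν u₀ hu₀ N U hU t ht).trans (le_max_right _ _)⟩

/-- The qualified faces of Thm 2.1 follow from the unqualified ones. [cite: Higgins2026, Thm 2.1 p.5 l.59–62] -/
theorem theorem21_RK_pop_of (h : Theorem21_RK) : Theorem21_RK_pop :=
  fun ν hν u₀ hu₀ N _ U hU K hK T hT hD => h ν hν u₀ hu₀ N U hU K hK T hT hD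

/-- Idem for the monotonicity face. [cite: Higgins2026, Thm 2.1 p.5 l.59–62] -/
theorem theorem21_mono_pop_of (h : Theorem21_mono) : Theorem21_mono_pop :=
  fun ν hν u₀ hu₀ N _ U hU T hT => h ν hν u₀ hu₀ N U hU T hT

/-- **Step 7 HOLDS (kernel)** — the tree's maximal classical solution with the enstrophy blow-up
alternative on `𝕋³` (`Torus.exists_maximal_classicalNS_anyMean`, RRS 2016 §6.3/§8.1): an a priori
enstrophy bound excludes the blow-up branch, and the maximality clause gives uniqueness on `[0, ∞)`.
[cite: RobinsonRodrigoSadowskiCUP2016, §6.3 p. 108, §8.1 p. 122] [cite: Higgins2026, Thm 3.1 proof p.8 l.57–61] -/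
theorem regularity31_holds : Regularity31 := by
  intro ν hν u₀ hu₀ hB
  obtain ⟨B, hB⟩ := hB
  obtain ⟨u, p, hu0, hcases⟩ :=
    Torus.exists_maximal_classicalNS_anyMean (d := Fin 3) (by simp) hν hu₀.1 hu₀.2
  have hπ : (0 : ℝ) < 8 * Real.pi ^ 2 := by positivity
  rcases hcases with ⟨hglob, hmax⟩ | ⟨T, hT, hcl, hnb, -⟩
  · refine ⟨⟨u, p, hglob, hu0⟩, ?_⟩
    intro v w q r hv hv0 hw hw0 t ht
    rcases ht.eq_or_lt with rfl | ht'
    · rw [hw0, hv0]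
    · have hvu : ∀ s ∈ Icc 0 t, v s = u s :=
        hmax t v q (hv.mono Icc_subset_Ici_self (uniqueDiffOn_Icc ht')) hv0
      have hwu : ∀ s ∈ Icc 0 t, w s = u s :=
        hmax t w r (hw.mono Icc_subset_Ici_self (uniqueDiffOn_Icc ht')) hw0
      rw [hvu t ⟨ht, le_rfl⟩, hwu t ⟨ht, le_rfl⟩]
  · exfalso
    refine hnb ⟨8 * Real.pi ^ 2 * B, ?_⟩
    rintro _ ⟨t, ht, rfl⟩
    have h := hB T u p hcl hu0 t ht
    unfold enstrophy at h
    rwa [div_le_iff₀ hπ, mul_comm] at h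

/-- **The uniqueness half of Thm 3.1 HOLDS (kernel), unconditionally**: classical solutions of the
unforced system on `𝕋³ × [0, ∞)` from the same smooth divergence-free datum coincide (maximality
clause of `Torus.exists_maximal_classicalNS_anyMean` in either branch).
[cite: RobinsonRodrigoSadowskiCUP2016, §6.3 p. 108 (Thm. 6.10 uniqueness)] [cite: Higgins2026, Thm 3.1 p.8 l.61] -/
theorem claimedUniqueness_holds : ClaimedUniqueness := by
  intro ν hν u₀ hs hd v w q r hv hv0 hw hw0 t ht
  rcases ht.eq_or_lt with rfl | ht'
  · rw [hw0, hv0]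
  obtain ⟨u, p, -, hcases⟩ :=
    Torus.exists_maximal_classicalNS_anyMean (d := Fin 3) (by simp) hν hs hd
  have hvI := hv.mono Icc_subset_Ici_self (uniqueDiffOn_Icc ht')
  have hwI := hw.mono Icc_subset_Ici_self (uniqueDiffOn_Icc ht')
  rcases hcases with ⟨-, hmax⟩ | ⟨T, -, -, -, hmax⟩
  · rw [hmax t v q hvI hv0 t ⟨ht, le_rfl⟩, hmax t w r hwI hw0 t ⟨ht, le_rfl⟩]
  · rw [(hmax t v q hvI hv0).2 t ⟨ht, le_rfl⟩, (hmax t w r hwI hw0).2 t ⟨ht, le_rfl⟩]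

/-- **COMPOSITION OF THE PRINTED CHAIN (PROVED)** — Thm 3.1's proof p.8 l.39–61: Thm 2.6 gives one
bound `Ω_max(E(0), ν)` for all Galerkin enstrophies from `P_N u₀` (Step 5); it passes to every
classical solution from `u₀` (Step 6); the a priori bound yields the unique global solution (Step 7).
[cite: Higgins2026, Thm 3.1 proof p.8 l.39–61] -/
theorem claim_of_steps (h26 : Theorem26) (hP : GalerkinPassage) (hR : Regularity31) :
    ClaimedTheorem := by
  obtain ⟨Ωmax, hΩ⟩ := h26
  have key : ∀ ν : ℝ, 0 < ν → ∀ u₀ : T3 → E3, IsDatum u₀ →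
      (∃ (u : ℝ → T3 → E3) (p : ℝ → T3 → ℝ),
        Torus.IsClassicalNSSolutionOn (Ici 0) ν 0 u p ∧ u 0 = u₀) ∧
      ∀ (u v : ℝ → T3 → E3) (p q : ℝ → T3 → ℝ),
        Torus.IsClassicalNSSolutionOn (Ici 0) ν 0 u p → u 0 = u₀ →
        Torus.IsClassicalNSSolutionOn (Ici 0) ν 0 v q → v 0 = u₀ → ∀ t : ℝ, 0 ≤ t → v t = u t :=
    fun ν hν u₀ hu₀ => hR ν hν u₀ hu₀ ⟨Ωmax (energy u₀) ν, fun T v q hv hv0 =>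
      hP ν hν u₀ hu₀ _ (fun N U hU t ht => hΩ ν hν u₀ hu₀ N U hU t ht) T v q hv hv0⟩
  exact ⟨fun ν hν u₀ hs hd => (key ν hν u₀ ⟨hs, hd⟩).1,
    fun ν hν u₀ hs hd => (key ν hν u₀ ⟨hs, hd⟩).2⟩

/-- The same composition from the lineage face (the bound `max(Ω(u₀), Ω_max)` is still one number
per datum). [cite: Higgins2026, Thm 3.1 proof p.8 l.39–61] -/
theorem claim_of_steps_max (h26 : Theorem26_max) (hP : GalerkinPassage) (hR : Regularity31) :
    ClaimedTheorem := by
  obtain ⟨Ωmax, hΩ⟩ := h26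
  have key : ∀ ν : ℝ, 0 < ν → ∀ u₀ : T3 → E3, IsDatum u₀ →
      (∃ (u : ℝ → T3 → E3) (p : ℝ → T3 → ℝ),
        Torus.IsClassicalNSSolutionOn (Ici 0) ν 0 u p ∧ u 0 = u₀) ∧
      ∀ (u v : ℝ → T3 → E3) (p q : ℝ → T3 → ℝ),
        Torus.IsClassicalNSSolutionOn (Ici 0) ν 0 u p → u 0 = u₀ →
        Torus.IsClassicalNSSolutionOn (Ici 0) ν 0 v q → v 0 = u₀ → ∀ t : ℝ, 0 ≤ t → v t = u t :=
    fun ν hν u₀ hu₀ => hR ν hν u₀ hu₀ ⟨max (enstrophy u₀) (Ωmax (energy u₀) ν), fun T v q hv hv0 =>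
      hP ν hν u₀ hu₀ _ (fun N U hU t ht => hΩ ν hν u₀ hu₀ N U hU t ht) T v q hv hv0⟩
  exact ⟨fun ν hν u₀ hs hd => (key ν hν u₀ ⟨hs, hd⟩).1,
    fun ν hν u₀ hs hd => (key ν hν u₀ ⟨hs, hd⟩).2⟩

/-- With Step 7 discharged: Thm 2.6 and the Galerkin passage already give the claim.
[cite: Higgins2026, Thm 3.1 proof p.8 l.39–61] -/
theorem claim_of_thm26 (h26 : Theorem26) (hP : GalerkinPassage) : ClaimedTheorem :=
  claim_of_steps h26 hP regularity31_holds

/-- **CLAY LINK (PROVED)**: the claimed statement decides Clay (B) — `ClaimedExistence` is the leaf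
`NavierStokesExistenceSmoothPeriodic` in torus vocabulary (tree Δ1 bridge, unit period; Fefferman
(8)/(10)/(11)), and `clayPeriodic.Regularity` is that leaf by `Iff.rfl`.
[cite: FeffermanClay2006, (B) with (8) (10) (11) p. 2] [cite: Higgins2026, Thm 3.1 p.8 l.36–38] -/
theorem clay_of_claimed (h : ClaimedTheorem) : clayPeriodic.Regularity :=
  clayPeriodic_regularity_iff.2 (navierStokesExistenceSmoothPeriodic_iff_torus.2 h.1)

/-- Conversely Clay (B) gives the existence half of Thm 3.1 (so `ClaimedExistence` is EXACTLY (B)).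
[cite: FeffermanClay2006, (B) p. 2] -/
theorem claimedExistence_of_clayB (h : clayPeriodic.Regularity) : ClaimedExistence :=
  navierStokesExistenceSmoothPeriodic_iff_torus.1 (clayPeriodic_regularity_iff.1 h)

/-! ## Appendix (ns-claims-typist-6 g6, D-0026 in-file discharge; append-only — nothing above is changed,
no Step is asserted): Step 3 `Theorem23_coupling` HOLDS

Thm 2.3's coupling sentence (p.6 l.24–26) at the typed grain is elementary lattice geometry: for
`N ≥ 2K + 1` and `k, p` in the nearest-integer shell `K` (`|k|, |p| < K + ½`), the mediating wave vector
satisfies `|k − p| ≤ |k| + |p| < 2K + 1 ≤ N`, hence `|k − p|² ≤ N²` and the mode `k − p` is retained by the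
truncation. The graph-theoretic content of [1] (`G_K = K_{n_K}`, Fiedler value) is not re-typed, as
recorded in the module docstring. -/

/-- The lattice norm `|k|` is the Euclidean norm of the real cast of `k ∈ ℤ³`. [folklore] -/
private theorem latt_eq_norm (k : Z3) :
    latt k = ‖(WithLp.toLp 2 fun i => (k i : ℝ) : EuclideanSpace ℝ (Fin 3))‖ := by
  rw [latt, EuclideanSpace.norm_eq, Torus.freqNormSq]
  congr 1
  refine Finset.sum_congr rfl fun i _ => ?_
  simp [Real.norm_eq_abs, sq_abs]

/-- `|k| ≥ 0`. [folklore] -/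
private theorem latt_nonneg (k : Z3) : 0 ≤ latt k := Real.sqrt_nonneg _

/-- Triangle inequality on the lattice: `|k − p| ≤ |k| + |p|`. [folklore] -/
private theorem latt_sub_le (k p : Z3) : latt (k - p) ≤ latt k + latt p := by
  rw [latt_eq_norm, latt_eq_norm, latt_eq_norm]
  have : (WithLp.toLp 2 fun i => ((k - p) i : ℝ) : EuclideanSpace ℝ (Fin 3)) =
      (WithLp.toLp 2 fun i => (k i : ℝ)) - (WithLp.toLp 2 fun i => (p i : ℝ)) := by
    ext i; simp
  rw [this]; exact norm_sub_le _ _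

/-- `|k|²` (the tree's `Torus.freqNormSq`) is the square of `|k|`. [folklore] -/
private theorem freqNormSq_eq_latt_sq (k : Z3) : Torus.freqNormSq k = latt k ^ 2 := by
  rw [latt, Real.sq_sqrt (Torus.freqNormSq_nonneg k)]

/-- **Step 3 HOLDS (kernel)** — Thm 2.3 (Triad Graph Saturation, [1]) p.6 l.24–26 at the typed grain
(«Every pair of modes within shell K is coupled by the NS nonlinearity»): for `N ≥ 2K + 1` and `k, p` in
shell `K`, `|k − p| ≤ |k| + |p| < 2K + 1 ≤ N`, so `|k − p|² ≤ N²` and the mediating mode is retained.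
Elementary; moves the docstring's «TRUE-type lattice fact» to the in-file column. The hypothesis `k ≠ p`
is not needed. [cite: Higgins2026, Thm 2.3 p.6 l.24–26] -/
theorem theorem23_coupling_holds : Theorem23_coupling := by
  intro N K hNK k hk p hp _hkp
  simp only [shell, Finset.mem_filter] at hk hp
  have hk2 := hk.2.2; have hp2 := hp.2.2
  have hN : (2 * K + 1 : ℝ) ≤ N := by exact_mod_cast hNK
  have hlt : latt (k - p) < (N : ℝ) := by
    have := latt_sub_le k p; linarith
  rw [freqNormSq_eq_latt_sq]
  exact pow_le_pow_left₀ (latt_nonneg _) hlt.le 2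

/-! ## Rev 3 (typist-7 g7, D-0026 append-only after rev 2 = typist-6 g6 `theorem23_coupling_holds`; statements of rev 1 untouched): Step 1 discharged and
the GLUE «(3)–(5) ⇒ (4)» of Thm 2.6's printed proof as a kernel implication

`phase1Bound_holds` — the Phase-1 bound «Ω^(N)(t) ≤ N²E(0)» (p.7 l.27–30) from the band limit
`|k| ≤ N`, the Galerkin energy identity (force `0`) and `E(P_N u₀) ≤ E(u₀)`.
`thm26_of_kol : Kol_perShell → Kol_tail → Theorem26` — REF-4 flag (e): the arithmetic of p.7 l.35 –
p.8 l.21 composes in the kernel once the consequence-grain items (3)–(5) are granted: shell partition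
`Ω^(N) = Σ_{K ≤ N} Ω_K` (`enstrophy_eq_sum_shell`, nearest-integer shells are a disjoint cover of the
Fourier ball), `Ω_0 = 0`, `Ω_K ≤ (9/4)K²E_K` (`K ≥ 1`), at most `⌊K_d⌋ ≤ K_d` shells below the
dissipation scale. So within the printed proof of Thm 2.6 the load sits in `Kol_perShell` / `Kol_tail`
(Remark 2.7 items (3)–(5), «consequences of the Kolmogorov cascade theory»), not in the bookkeeping. -/

/-- «since total energy E(t) ≤ E(0)» along the (unforced) Galerkin trajectory — the exact energy
identity of `Torus.IsGalerkinTrajectory` with force `0`. [cite: Higgins2026, §2.1 (2) p.5 l.8–16; Thm 2.6 proof p.7 l.28] -/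
theorem energy_le_energy_zero {ν : ℝ} (hν : 0 ≤ ν) {N : ℕ} {U : ℝ → T3 → E3}
    (hU : Torus.IsGalerkinTrajectory ν 0 N U) {t : ℝ} (ht : 0 ≤ t) :
    energy (U t) ≤ energy (U 0) := by
  have h := hU.energy_eq_zero ht
  have h0 : (∫ τ in (0 : ℝ)..t, ∫ x, ⟪(0 : T3 → E3) x, U τ x⟫) = 0 := by simp
  rw [h0, add_zero] at h
  have hnn : 0 ≤ ν * (∫⁻ τ in Ioo 0 t, Torus.eGradNormSq (U τ)).toReal :=
    mul_nonneg hν ENNReal.toReal_nonneg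
  unfold energy
  linarith

/-- Band limit «at truncation N»: the spectral enstrophy of a Galerkin slice is at most `N²` times its
energy (modes `|k| ≤ N` only). [cite: Higgins2026, Thm 2.6 proof p.7 l.28–29; §2.1 p.4 l.44–45] -/
theorem enstrophy_le_sq_mul_energy {ν : ℝ} {N : ℕ} {U : ℝ → T3 → E3}
    (hU : Torus.IsGalerkinTrajectory ν 0 N U) {t : ℝ} (ht : 0 ≤ t) :
    enstrophy (U t) ≤ (N : ℝ) ^ 2 * energy (U t) := by
  have hs : Torus.IsSmooth (U t) := hU.isSmooth ht
  have hA := Torus.hasSum_freq_mul_norm_sq_mFourierCoeff hs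
  have hK := Torus.hasSum_sq_norm_mFourierCoeff_complexify (hs.memLp 2)
  have hB : HasSum (fun k : Z3 => 4 * Real.pi ^ 2 * (N : ℝ) ^ 2 *
      ‖UnitAddTorus.mFourierCoeff (EuclideanSpace.complexify ∘ U t) k‖ ^ 2)
      (4 * Real.pi ^ 2 * (N : ℝ) ^ 2 * ∫ x, ‖U t x‖ ^ 2) := hK.mul_left _
  have hle : Torus.gradNormSq (U t) ≤ 4 * Real.pi ^ 2 * (N : ℝ) ^ 2 * ∫ x, ‖U t x‖ ^ 2 := by
    refine hasSum_le (fun k => ?_) hA hB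
    by_cases hk : (N : ℝ) ^ 2 < Torus.freqNormSq k
    · rw [hU.mFourierCoeff_eq_zero ht hk]
      simp
    · push Not at hk
      have h0 : 0 ≤ ‖UnitAddTorus.mFourierCoeff (EuclideanSpace.complexify ∘ U t) k‖ ^ 2 :=
        sq_nonneg _
      have hπ : 0 ≤ 4 * Real.pi ^ 2 := by positivity
      exact mul_le_mul_of_nonneg_right (mul_le_mul_of_nonneg_left hk hπ) h0
  have hπ : (0 : ℝ) < 8 * Real.pi ^ 2 := by positivity
  unfold enstrophy energy Torus.kineticEnergy
  rw [div_le_iff₀ hπ]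
  nlinarith

/-- **Step 1 HOLDS (kernel)**: «Ω^(N)(t) ≤ N²E(0)» (p.7 l.28–29) — band limit + energy identity +
`E(P_N u₀) ≤ E(u₀)`. [cite: Higgins2026, Thm 2.6 proof p.7 l.27–30] -/
theorem phase1Bound_holds : Phase1Bound := by
  intro ν hν u₀ hu₀ N U hU t ht
  have h1 := enstrophy_le_sq_mul_energy hU.1 ht
  have h2 := energy_le_energy_zero hν.le hU.1 ht
  have h3 : energy (U 0) ≤ energy u₀ := by
    rw [hU.2]
    exact Torus.kineticEnergy_fourierTruncate_le (hu₀.1.memLp 2) N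
  have hN : 0 ≤ (N : ℝ) ^ 2 := sq_nonneg _
  nlinarith

/-! ### Shell bookkeeping on the integer lattice -/

/-- Each coordinate is bounded by the lattice norm. [folklore] -/
private theorem abs_coord_le_latt (k : Z3) (i : Fin 3) : |(k i : ℝ)| ≤ latt k := by
  rw [← Real.sqrt_sq_eq_abs]
  exact Real.sqrt_le_sqrt (by
    unfold Torus.freqNormSq
    exact Finset.single_le_sum (f := fun j => ((k j : ℝ)) ^ 2) (fun j _ => sq_nonneg _)
      (Finset.mem_univ i))

/-- The nearest-integer shell index `⌊|k| + ½⌋` of a wave vector («shell K = |k|»).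
[cite: Higgins2026, §1.2 p.3 l.50–52] -/
def shellIndex (k : Z3) : ℕ := ⌊latt k + 1 / 2⌋₊

/-- Every wave vector lies in its nearest-integer shell. [cite: Higgins2026, §1.2 p.3 l.50–52] -/
theorem mem_shell_shellIndex (k : Z3) : k ∈ shell (shellIndex k) := by
  have h0 := latt_nonneg k
  have hfl : (shellIndex k : ℝ) ≤ latt k + 1 / 2 := Nat.floor_le (by linarith)
  have hlt : latt k + 1 / 2 < (shellIndex k : ℝ) + 1 := Nat.lt_floor_add_one _
  unfold shell
  rw [Finset.mem_filter, Fintype.mem_piFinset]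
  refine ⟨fun i => ?_, by linarith, by linarith⟩
  rw [Finset.mem_Icc]
  have hi := abs_coord_le_latt k i
  have hlt' : |(k i : ℝ)| < (shellIndex k : ℝ) + 1 := by linarith
  have hint : |k i| ≤ (shellIndex k : ℤ) := by
    have h2 : ((|k i| : ℤ) : ℝ) < (shellIndex k : ℝ) + 1 := by rw [Int.cast_abs]; exact hlt'
    have h3 : |k i| < (shellIndex k : ℤ) + 1 := by exact_mod_cast h2
    omega
  constructor <;> [have := neg_abs_le (k i); have := le_abs_self (k i)] <;> omega

/-- Distinct shells are disjoint. [cite: Higgins2026, §1.2 p.3 l.50–52] -/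
theorem disjoint_shell {K K' : ℕ} (h : K ≠ K') : Disjoint (shell K) (shell K') := by
  rw [Finset.disjoint_left]
  intro k hk hk'
  unfold shell at hk hk'
  rw [Finset.mem_filter] at hk hk'
  obtain ⟨-, h1, h2⟩ := hk
  obtain ⟨-, h3, h4⟩ := hk'
  have h5 : (K : ℝ) < K' + 1 := by linarith
  have h6 : (K' : ℝ) < K + 1 := by linarith
  have h7 : K < K' + 1 := by exact_mod_cast h5
  have h8 : K' < K + 1 := by exact_mod_cast h6
  omega

/-- A member of shell `K` has `|k| < K + ½`, hence `|k|² ≤ (K + ½)²`. [cite: Higgins2026, §1.2 p.3 l.50–52] -/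
theorem freqNormSq_le_of_mem_shell {K : ℕ} {k : Z3} (hk : k ∈ shell K) :
    Torus.freqNormSq k ≤ ((K : ℝ) + 1 / 2) ^ 2 := by
  unfold shell at hk
  rw [Finset.mem_filter] at hk
  rw [freqNormSq_eq_latt_sq]
  have h0 := latt_nonneg k
  nlinarith [hk.2.2]

/-- Shell `0` (the mean mode: `|k| < ½` forces `|k|² = 0`) carries no enstrophy.
[cite: Higgins2026, §2.1 p.4 l.46–53] -/
theorem shellEnstrophy_zero (v : T3 → E3) : shellEnstrophy 0 v = 0 := by
  unfold shellEnstrophy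
  rw [Finset.sum_eq_zero, mul_zero]
  intro k hk
  have h := freqNormSq_le_of_mem_shell hk
  norm_num at h
  -- `freqNormSq k` is a sum of integer squares `≤ 1/4`, hence `0`
  have hint : ∃ m : ℤ, Torus.freqNormSq k = m := ⟨∑ i, k i ^ 2, by
    unfold Torus.freqNormSq; push_cast; rfl⟩
  obtain ⟨m, hm⟩ := hint
  have h0 := Torus.freqNormSq_nonneg k
  have hm0 : m = 0 := by
    have : (m : ℝ) ≤ 1 / 4 := hm ▸ h
    have : (0 : ℝ) ≤ m := hm ▸ h0
    have h1 : m < 1 := by exact_mod_cast (by linarith : (m : ℝ) < 1)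
    have h2 : 0 ≤ m := by exact_mod_cast this
    omega
  rw [hm, hm0]
  simp

/-- `E_K ≥ 0`. [folklore] -/
private theorem shellEnergy_nonneg (K : ℕ) (v : T3 → E3) : 0 ≤ shellEnergy K v := by
  unfold shellEnergy; positivity

/-- `Ω_K ≥ 0`. [folklore] -/
private theorem shellEnstrophy_nonneg (K : ℕ) (v : T3 → E3) : 0 ≤ shellEnstrophy K v := by
  unfold shellEnstrophy
  refine mul_nonneg (by norm_num) (Finset.sum_nonneg fun k _ => ?_)
  have := Torus.freqNormSq_nonneg k
  positivity

/-- `Ω_K ≤ (K + ½)² E_K` on the nearest-integer shell (the print's «Ω_K = K²E_K» for `|k| = K`).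
[cite: Higgins2026, §5.1.3 p.15 l.34–41; Thm 2.6 proof p.7 l.38] -/
theorem shellEnstrophy_le (K : ℕ) (v : T3 → E3) :
    shellEnstrophy K v ≤ ((K : ℝ) + 1 / 2) ^ 2 * shellEnergy K v := by
  unfold shellEnstrophy shellEnergy
  have h : ∑ k ∈ shell K, Torus.freqNormSq k * ‖coeff v k‖ ^ 2 ≤
      ∑ k ∈ shell K, ((K : ℝ) + 1 / 2) ^ 2 * ‖coeff v k‖ ^ 2 :=
    Finset.sum_le_sum fun k hk =>
      mul_le_mul_of_nonneg_right (freqNormSq_le_of_mem_shell hk) (sq_nonneg _)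
  rw [← Finset.mul_sum] at h
  nlinarith [h]

/-- For `K ≥ 1`: `Ω_K ≤ (9/4) K² E_K` (`(K + ½)² ≤ (9/4)K²`). [cite: Higgins2026, §5.1.3 p.15 l.34–41; Thm 2.6 proof p.7 l.38] -/
theorem shellEnstrophy_le' {K : ℕ} (hK : 1 ≤ K) (v : T3 → E3) :
    shellEnstrophy K v ≤ 9 / 4 * ((K : ℝ) ^ 2 * shellEnergy K v) := by
  have hK' : (1 : ℝ) ≤ K := by exact_mod_cast hK
  have hE := shellEnergy_nonneg K v
  have h1 : ((K : ℝ) + 1 / 2) ^ 2 ≤ 9 / 4 * (K : ℝ) ^ 2 := by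
    nlinarith [mul_le_mul_of_nonneg_left hK' (by linarith : (0 : ℝ) ≤ K)]
  calc shellEnstrophy K v ≤ ((K : ℝ) + 1 / 2) ^ 2 * shellEnergy K v := shellEnstrophy_le K v
    _ ≤ (9 / 4 * (K : ℝ) ^ 2) * shellEnergy K v := mul_le_mul_of_nonneg_right h1 hE
    _ = 9 / 4 * ((K : ℝ) ^ 2 * shellEnergy K v) := by ring

/-- **Shell partition of the Galerkin enstrophy**: for a Galerkin mode of order `N`,
`Ω^(N) = Σ_{K ≤ N} Ω_K` (the nearest-integer shells `0 … N` are a disjoint cover of the Fourier ball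
`|k| ≤ N`). [cite: Higgins2026, §2.1 p.4 l.44–53; Thm 2.6 proof p.7 l.39–43] -/
theorem enstrophy_eq_sum_shell {N : ℕ} {v : T3 → E3} (hv : IsGalerkinMode N v) :
    enstrophy v = ∑ K ∈ Finset.range (N + 1), shellEnstrophy K v := by
  classical
  have hs : Torus.IsSmooth v := hv.isSmooth
  have hA := Torus.hasSum_freq_mul_norm_sq_mFourierCoeff hs
  set S : Finset Z3 := (Finset.range (N + 1)).biUnion shell with hS
  -- coefficients vanish off `S`
  have hzero : ∀ k ∉ S, 4 * Real.pi ^ 2 * Torus.freqNormSq k * ‖coeff v k‖ ^ 2 = 0 := by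
    intro k hk
    have hc : coeff v k = 0 := by
      by_contra hne
      apply hk
      rw [hS, Finset.mem_biUnion]
      refine ⟨shellIndex k, ?_, mem_shell_shellIndex k⟩
      rw [Finset.mem_range]
      -- `|k|² ≤ N²` since the coefficient is nonzero
      have hle : Torus.freqNormSq k ≤ (N : ℝ) ^ 2 := by
        by_contra hlt
        push Not at hlt
        exact hne (hv.mFourierCoeff_eq_zero hlt)
      have hl : latt k ≤ N := by
        rw [← Real.sqrt_sq (Nat.cast_nonneg N), latt]
        exact Real.sqrt_le_sqrt hle
      have : (shellIndex k : ℝ) ≤ latt k + 1 / 2 := Nat.floor_le (by linarith [latt_nonneg k])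
      have h2 : (shellIndex k : ℝ) < N + 1 := by linarith
      exact_mod_cast h2
    rw [hc]; simp
  have hsum : HasSum (fun k : Z3 => 4 * Real.pi ^ 2 * Torus.freqNormSq k * ‖coeff v k‖ ^ 2)
      (∑ k ∈ S, 4 * Real.pi ^ 2 * Torus.freqNormSq k * ‖coeff v k‖ ^ 2) :=
    hasSum_sum_of_ne_finset_zero hzero
  have heq : Torus.gradNormSq v = ∑ k ∈ S, 4 * Real.pi ^ 2 * Torus.freqNormSq k * ‖coeff v k‖ ^ 2 :=
    hA.unique hsum
  have hdisj : Set.PairwiseDisjoint (↑(Finset.range (N + 1)) : Set ℕ) shell :=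
    fun K _ K' _ hKK' => disjoint_shell hKK'
  rw [enstrophy, heq, hS, Finset.sum_biUnion hdisj]
  rw [Finset.sum_div]
  refine Finset.sum_congr rfl fun K _ => ?_
  unfold shellEnstrophy
  rw [Finset.mul_sum, Finset.sum_div]
  refine Finset.sum_congr rfl fun k _ => ?_
  have hπ : (Real.pi : ℝ) ^ 2 ≠ 0 := by positivity
  field_simp
  ring

/-- **GLUE (3)–(5) ⇒ (4) (kernel)** — the arithmetic of Thm 2.6's printed proof p.7 l.44 – p.8 l.21:
with `Ω^(N) = Σ_{K ≤ N} Ω_K` (shell partition), `Ω_0 = 0`, `Ω_K ≤ (9/4)K²E_K` for `K ≥ 1`, the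
per-shell bound (items (3)–(4), `Kol_perShell`) on the `⌊K_d⌋ ≤ K_d` shells below the dissipation
scale and the tail bound (item (5), `Kol_tail`) above it give ONE bound depending on `(E(0), ν)` only:
`Ω^(N)(t) ≤ K_d·(9/8)C₁E^{3/2}/ν + C′K_d·C E^{3/2}/ν` with `K_d = (C E^{3/2}/ν³)^{1/4}` — i.e. the literal
Thm 2.6 (and, up to rpow algebra, the explicit `C″E^{15/8}/ν^{7/4}` of p.8 l.3–21).
[cite: Higgins2026, Thm 2.6 proof p.7 l.35 – p.8 l.25; Remark 2.7 p.8 l.26–34] -/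
theorem thm26_of_kol (hP : Kol_perShell) (hT : Kol_tail) : Theorem26 := by
  classical
  obtain ⟨C₁, hC₁, hP⟩ := hP
  obtain ⟨C, C', hC, hC', hT⟩ := hT
  refine ⟨fun E ν => C' * (C * E ^ (3 / 2 : ℝ) / ν ^ 3) ^ (1 / 4 : ℝ) * (C * E ^ (3 / 2 : ℝ)) / ν +
      (C * E ^ (3 / 2 : ℝ) / ν ^ 3) ^ (1 / 4 : ℝ) * (9 / 8 * C₁ * E ^ (3 / 2 : ℝ) / ν), ?_⟩
  intro ν hν u₀ hu₀ N U hU t ht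
  set E := energy u₀ with hE
  set Kd : ℝ := (C * E ^ (3 / 2 : ℝ) / ν ^ 3) ^ (1 / 4 : ℝ) with hKd
  set M : ℝ := 9 / 8 * C₁ * E ^ (3 / 2 : ℝ) / ν with hM
  have hE0 : 0 ≤ E := Torus.kineticEnergy_nonneg _
  have hE32 : 0 ≤ E ^ (3 / 2 : ℝ) := Real.rpow_nonneg hE0 _
  have hKd0 : 0 ≤ Kd := Real.rpow_nonneg (by positivity) _
  have hM0 : 0 ≤ M := by positivity
  rw [enstrophy_eq_sum_shell (hU.1.isGalerkinMode t ht),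
    ← Finset.sum_filter_add_sum_filter_not (Finset.range (N + 1)) (fun K : ℕ => Kd < (K : ℝ))]
  have htail := hT ν hν u₀ hu₀ N U hU t ht
  have hlow : ∑ K ∈ (Finset.range (N + 1)).filter (fun K : ℕ => ¬ Kd < (K : ℝ)),
      shellEnstrophy K (U t) ≤ Kd * M := by
    have hper : ∀ K ∈ (Finset.range (N + 1)).filter (fun K : ℕ => ¬ Kd < (K : ℝ)),
        shellEnstrophy K (U t) ≤ if 1 ≤ K then M else 0 := by
      intro K _
      split_ifs with h1
      · calc shellEnstrophy K (U t) ≤ 9 / 4 * ((K : ℝ) ^ 2 * shellEnergy K (U t)) :=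
              shellEnstrophy_le' h1 _
          _ ≤ 9 / 4 * (C₁ * E ^ (3 / 2 : ℝ) / (2 * ν)) := by
              gcongr
              exact hP ν hν u₀ hu₀ N U hU t ht K h1
          _ = M := by rw [hM]; ring
      · have h0 : K = 0 := by omega
        subst h0
        rw [shellEnstrophy_zero]
    refine (Finset.sum_le_sum hper).trans ?_
    rw [Finset.sum_ite, Finset.sum_const_zero, add_zero, Finset.sum_const, nsmul_eq_mul]
    refine mul_le_mul_of_nonneg_right ?_ hM0
    have hsub : ((Finset.range (N + 1)).filter (fun K : ℕ => ¬ Kd < (K : ℝ))).filter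
        (fun K => 1 ≤ K) ⊆ Finset.Icc 1 ⌊Kd⌋₊ := by
      intro K hK
      simp only [Finset.mem_filter, Finset.mem_range, not_lt] at hK
      rw [Finset.mem_Icc]
      exact ⟨hK.2, Nat.le_floor hK.1.2⟩
    calc ((((Finset.range (N + 1)).filter (fun K : ℕ => ¬ Kd < (K : ℝ))).filter
            (fun K => 1 ≤ K)).card : ℝ)
        ≤ ((Finset.Icc 1 ⌊Kd⌋₊).card : ℝ) := by exact_mod_cast Finset.card_le_card hsub
      _ = ⌊Kd⌋₊ := by simp
      _ ≤ Kd := Nat.floor_le hKd0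
  calc _ ≤ C' * Kd * (C * E ^ (3 / 2 : ℝ)) / ν + Kd * M := add_le_add htail hlow
    _ = _ := by rw [hM]

/-- With the glue, the explicit face is not needed for the chain: items (3)–(5) at the consequence
grain already give the literal Thm 2.6. [cite: Higgins2026, Thm 2.6 proof p.7–8] -/
theorem claim_of_kol (hP : Kol_perShell) (hT : Kol_tail) (hG : GalerkinPassage) : ClaimedTheorem :=
  claim_of_thm26 (thm26_of_kol hP hT) hG

/-! ### Rev 4 (APPEND-ONLY, typist-7 g7, 2026-08-27): explicit-face glue (REF-4 flag (e))

`thm26_explicit_of_kol : Kol_perShell → Kol_tail → Theorem26_explicit` — the exponent arithmetic of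
p.8 l.3–21 in the kernel; records-grade (token `Theorem26` / #142 untouched; `Theorem26_explicit`,
`Kol_perShell` are kernel-false by p530799, so this is a glue column, not a discharge). -/

/-- p.8 l.3–21 arithmetic: `K_d · E^{3/2}/ν = C^{1/4} E^{15/8} / ν^{7/4}` for
`K_d = (C E^{3/2}/ν³)^{1/4}`. [cite: Higgins2026, Thm 2.6 proof p.8 l.3–21] -/
private lemma kd_mul_eq {C E ν : ℝ} (hC : 0 ≤ C) (hE : 0 ≤ E) (hν : 0 < ν) :
    (C * E ^ (3 / 2 : ℝ) / ν ^ 3) ^ (1 / 4 : ℝ) * E ^ (3 / 2 : ℝ) / ν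
      = C ^ (1 / 4 : ℝ) * E ^ (15 / 8 : ℝ) / ν ^ (7 / 4 : ℝ) := by
  have hν0 : 0 ≤ ν := hν.le
  have h1 : (C * E ^ (3 / 2 : ℝ) / ν ^ 3) ^ (1 / 4 : ℝ)
      = C ^ (1 / 4 : ℝ) * E ^ (3 / 8 : ℝ) / ν ^ (3 / 4 : ℝ) := by
    rw [Real.div_rpow (by positivity) (by positivity), Real.mul_rpow hC (by positivity),
      ← Real.rpow_mul hE, ← Real.rpow_natCast ν 3, ← Real.rpow_mul hν0]
    norm_num
  rw [h1, div_mul_eq_mul_div, div_div, mul_assoc, ← Real.rpow_add' hE (by norm_num),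
    ← Real.rpow_add_one hν.ne']
  norm_num

/-- **GLUE, explicit face (REF-4 flag (e); p.8 l.1–21 «Substituting K_d: Ω_max ∼ … ≤
C′·E(0)^{15/8}/ν^{7/4}»)**: items (3)–(5) at the consequence grain (`Kol_perShell`, `Kol_tail`)
imply the explicit face `Theorem26_explicit` with `C′ = (C′_tail·C + 9C₁/8)·C^{1/4}` — the printed
exponent arithmetic composes in the kernel; the load of Thm 2.6's proof sits in (3)–(5).
[cite: Higgins2026, Thm 2.6 proof p.7 l.35 – p.8 l.21] -/
theorem thm26_explicit_of_kol (hP : Kol_perShell) (hT : Kol_tail) : Theorem26_explicit := by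
  classical
  obtain ⟨C₁, hC₁, hP⟩ := hP
  obtain ⟨C, C', hC, hC', hT⟩ := hT
  refine ⟨(C' * C + 9 / 8 * C₁) * C ^ (1 / 4 : ℝ), by positivity, ?_⟩
  intro ν hν u₀ hu₀ N U hU t ht
  set E := energy u₀ with hE
  set Kd : ℝ := (C * E ^ (3 / 2 : ℝ) / ν ^ 3) ^ (1 / 4 : ℝ) with hKd
  set M : ℝ := 9 / 8 * C₁ * E ^ (3 / 2 : ℝ) / ν with hM
  have hE0 : 0 ≤ E := Torus.kineticEnergy_nonneg _
  have hE32 : 0 ≤ E ^ (3 / 2 : ℝ) := Real.rpow_nonneg hE0 _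
  have hKd0 : 0 ≤ Kd := Real.rpow_nonneg (by positivity) _
  have hM0 : 0 ≤ M := by positivity
  rw [enstrophy_eq_sum_shell (hU.1.isGalerkinMode t ht),
    ← Finset.sum_filter_add_sum_filter_not (Finset.range (N + 1)) (fun K : ℕ => Kd < (K : ℝ))]
  have htail := hT ν hν u₀ hu₀ N U hU t ht
  have hlow : ∑ K ∈ (Finset.range (N + 1)).filter (fun K : ℕ => ¬ Kd < (K : ℝ)),
      shellEnstrophy K (U t) ≤ Kd * M := by
    have hper : ∀ K ∈ (Finset.range (N + 1)).filter (fun K : ℕ => ¬ Kd < (K : ℝ)),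
        shellEnstrophy K (U t) ≤ if 1 ≤ K then M else 0 := by
      intro K _
      split_ifs with h1
      · calc shellEnstrophy K (U t) ≤ 9 / 4 * ((K : ℝ) ^ 2 * shellEnergy K (U t)) :=
              shellEnstrophy_le' h1 _
          _ ≤ 9 / 4 * (C₁ * E ^ (3 / 2 : ℝ) / (2 * ν)) := by
              gcongr
              exact hP ν hν u₀ hu₀ N U hU t ht K h1
          _ = M := by rw [hM]; ring
      · have h0 : K = 0 := by omega
        subst h0
        rw [shellEnstrophy_zero]
    refine (Finset.sum_le_sum hper).trans ?_
    rw [Finset.sum_ite, Finset.sum_const_zero, add_zero, Finset.sum_const, nsmul_eq_mul]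
    refine mul_le_mul_of_nonneg_right ?_ hM0
    have hsub : ((Finset.range (N + 1)).filter (fun K : ℕ => ¬ Kd < (K : ℝ))).filter
        (fun K => 1 ≤ K) ⊆ Finset.Icc 1 ⌊Kd⌋₊ := by
      intro K hK
      simp only [Finset.mem_filter, Finset.mem_range, not_lt] at hK
      rw [Finset.mem_Icc]
      exact ⟨hK.2, Nat.le_floor hK.1.2⟩
    calc ((((Finset.range (N + 1)).filter (fun K : ℕ => ¬ Kd < (K : ℝ))).filter
            (fun K => 1 ≤ K)).card : ℝ)
        ≤ ((Finset.Icc 1 ⌊Kd⌋₊).card : ℝ) := by exact_mod_cast Finset.card_le_card hsub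
      _ = ⌊Kd⌋₊ := by simp
      _ ≤ Kd := Nat.floor_le hKd0
  calc _ ≤ C' * Kd * (C * E ^ (3 / 2 : ℝ)) / ν + Kd * M := add_le_add htail hlow
    _ = (C' * C + 9 / 8 * C₁) * (Kd * E ^ (3 / 2 : ℝ) / ν) := by rw [hM]; ring
    _ = (C' * C + 9 / 8 * C₁) * (C ^ (1 / 4 : ℝ) * E ^ (15 / 8 : ℝ) / ν ^ (7 / 4 : ℝ)) := by
        rw [hKd, kd_mul_eq hC.le hE0 hν]
    _ = _ := by ring

/-- Hence the chain through the explicit face also closes modulo (3)–(5) and the classical passage.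
[cite: Higgins2026, Thm 2.6 proof p.7–8; §3.1 p.8] -/
theorem claim_of_kol_explicit (hP : Kol_perShell) (hT : Kol_tail) (hG : GalerkinPassage) :
    ClaimedTheorem :=
  claim_of_thm26 (theorem26_of_explicit (thm26_explicit_of_kol hP hT)) hG

end Literature.Claims.NS.Higgins2026

end

-- WHAT THIS IS NOT: not a claim about NS regularity or blow-up; not a claim about any author beyond the
-- typed locator.
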